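/-
Copyright (c) 2026. All rights reserved.
Released under Apache 2.0 license as described in the file LICENSE.
Authors: abc-iut cell, prover seat abc-iut-f-196 (F fact-proving wave, tranche 196), over the statements of
abc-iut-L5-t4 (`ThetaPMEllHodgeTheatersF.lean`) and abc-iut-L5-t3's KIT-RULE inhabitant `HodgeTheaterModel.unitsLink`.
-/
import Literature.IUT.HodgeTheaters.ThetaPMEllHodgeTheatersFProofs
import Literature.IUT.HodgeTheaters.PMBaseBridgePropsProofs8
import Literature.IUT.HodgeTheaters.PMBaseNegCompatSub
import Literature.IUT.HodgeTheaters.HodgeTheaterModelFKitCor56i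
import Literature.IUT.HodgeTheaters.PlaceKitBridge
import HarnessLib

/-!
# [IUTchI] Cor 6.12 (i)/(ii), Rmk 6.12.1 at the `ℱ`-level: instance forms at the `ℱ`-kit of GENUINE initial
# Θ-data (`HodgeTheaterModel.unitsLink D`), and law (β) for the toy place kit of `D` (proof-only)

S. Mochizuki, *Inter-universal Teichmüller theory I*, kurims manuscript (May 2020), §6: Cor 6.12 (i), (ii)
p. 173, Rmk 6.12.1 p. 174; Example 6.3 (ii) p. 161 (the `[−1]`-compatibility, law (β)); Def 6.1 p. 156 (place
kits) [claim: Mochizuki2012, status: disputed].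

PROOF-ONLY companion (theorems only) of abc-iut-L5-t4's `ThetaPMEllHodgeTheatersF.lean`, FACT-LIST rows F-2604
`IsoFToDBijective` (three twins), F-2605 `PMBaseKit.FKit.Cor612iF`, F-2607 `PMBaseKit.FKit.GluingTorsorF`, F-2608
`PMBaseKit.FKit.FunctorialDynamicsPMF`; sequel of `ThetaPMEllHodgeTheatersFOfBase.lean` (same seat: the instance
forms at `FKit.ofBase` / `FKit.toy`).  Here the witness kit is indexed by GENUINE data: for every initial Θ-datum
`D : InitialThetaData F K Fbar E l P` ([IUTchI] Def 3.1; `F` a number field, `E` an elliptic curve, `l ≥ 5`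
prime), abc-iut-L5-t3's KIT-RULE inhabitant `HodgeTheaterModel.unitsLink D` of the §3 ↔ §5 dictionary
(`HodgeTheaterModelFKitWitness.lean`) is an `ℱ`-kit `(unitsLink D).toFKit` over the toy place kit
`InitialThetaData.PlaceKit.toy D` — abc-iut-L5-t4's `toyKit` re-indexed by (a copy of) the infinite set of places
`V̲` of `D` (`PlaceKitBridge.lean`) — at which Cor 5.3 (ii) HOLDS (`HodgeTheaterModel.isomFtoDBijective_unitsLink`).

* `PMBaseKit.Ex63.negCompatModel_reindex'` — law (β) `Ex63.NegCompatModel` (from which Prop 6.6 (ii)/(iii) and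
  Prop 6.8 (i) are proved in the tree) is stable under re-indexing a base kit (`PMBaseKit.reindex'`): every datum
  of the law lives AT a place;
* `InitialThetaData.negCompatModel_placeKitToy` — hence law (β) HOLDS for the toy place kit of every genuine `D`
  (from abc-iut-w4-d073's `Ex63.negCompatModel_toyKit`), so the (β)-conditional discharges of Prop 6.6 (ii)/(iii),
  Prop 6.8 (i) are UNCONDITIONAL there (`isoTorsor_placeKitToy`, `ellBridgeSymmetry_placeKitToy`);
* `HodgeTheaterModel.cor612iF_unitsLink`, `gluingTorsorF_unitsLink`, `functorialDynamicsPMF_unitsLink` and the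
  three `…isoFToDBijective_unitsLink` — rows F-2605 / F-2607 / F-2608 / F-2604 PROVED UNCONDITIONALLY at
  `(unitsLink D).toFKit` for EVERY initial Θ-datum `D`; `cor612_rmk6121_unitsLink` the joint form.

HONEST LABEL: `unitsLink D` is a KIT-RULE inhabitant (units model `{±1}`, toy local data) indexed by the genuine
places of `D`; a statement about the INTERFACE of Def 5.2 instantiated at genuine index data, not about the genuine
tempered Frobenioids.  The universal closures of all four rows are REFUTED (abc-iut-f-028,
`ThetaPMEllHodgeTheatersFClosures.lean`).  Nothing of [IUTchI] is asserted; no side taken on [IUTchIII] Cor 3.12;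
typed ≠ proved.
-/

namespace Literature.IUT.HodgeTheaters

open CategoryTheory

universe uK u v w

namespace PMBaseKit

namespace Ex63

variable {l : ℕ} {K : PMBaseKit.{uK} l}

/-- **Law (β) is stable under re-indexing** ([IUTchI] Ex 6.3 (ii) p. 161 / Def 6.1 p. 156): if the base kit `K`
satisfies `Ex63.NegCompatModel`, so does `K.reindex' W f bad arc` for any index map `f : W → 𝕍(K)` — the law is a
conjunction of per-place data (`model`, `labMap`, `phiEll`, `atV` at `f w`) and global data (`lifts`) left unchanged
by `reindex'`. [claim: Mochizuki2012, status: disputed] -/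
theorem negCompatModel_reindex' (h : NegCompatModel K) (W : Type) [DecidableEq W] (f : W → K.V)
    (bad arc : Finset W) : NegCompatModel (K.reindex' W f bad arc) :=
  fun w => h (f w)

end Ex63

end PMBaseKit

section Link

variable {F : Type u} {K : Type v} {Fbar : Type w} [Field F] [NumberField F] [Field K]
  [NumberField K] [Algebra F K] [Field Fbar] [Algebra F Fbar] [Algebra K Fbar]
  {E : WeierstrassCurve F} [E.IsElliptic] {l : ℕ} {P : BadPlacePredicates K}

namespace InitialThetaData

/-- **Law (β) `Ex63.NegCompatModel` HOLDS for the toy place kit `PlaceKit.toy D` of EVERY initial Θ-datum `D`**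
([IUTchI] Ex 6.3 (ii) p. 161 at Def 6.1's place kit indexed by `V̲`): pointwise it is abc-iut-w4-d073's
`Ex63.negCompatModel_toyKit` at the single place of `toyKit l hl` (`l ≥ 5`, so `l ≠ 2`).
[claim: Mochizuki2012, status: disputed] -/
theorem negCompatModel_placeKitToy (D : InitialThetaData F K Fbar E l P) :
    PMBaseKit.Ex63.NegCompatModel (PlaceKit.toy D).kit := by
  haveI : Fact l.Prime := ⟨D.l_prime⟩
  have hl : l ≠ 2 := by have := D.five_le_l; omega
  intro w
  exact PMBaseKit.Ex63.negCompatModel_toyKit l hl ()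

/-- **[IUTchI] Prop 6.6 (ii)** (p. 165) UNCONDITIONALLY over the toy place kit of every genuine `D`: the set of
isomorphisms between two `𝒟-Θ^{ell}`-bridges is an `𝔽_l^{⋊±}`-torsor in the typed sense
(`DThetaEllBridge.isoTorsor_of_negCompatModel` at `negCompatModel_placeKitToy`). [claim: Mochizuki2012, status: disputed] -/
theorem dThetaEllBridge_isoTorsor_placeKitToy (D : InitialThetaData F K Fbar E l P)
    (B₁ B₂ : (PlaceKit.toy D).kit.DThetaEllBridge) : PMBaseKit.DThetaEllBridge.IsoTorsor B₁ B₂ :=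
  PMBaseKit.DThetaEllBridge.isoTorsor_of_negCompatModel (negCompatModel_placeKitToy D) B₁ B₂

/-- **[IUTchI] Prop 6.6 (iii)** (p. 165) UNCONDITIONALLY over the toy place kit of every genuine `D`
(`DThetaPMEllHT.isoTorsor_of_negCompatModel` at `negCompatModel_placeKitToy`). [claim: Mochizuki2012, status: disputed] -/
theorem dThetaPMEllHT_isoTorsor_placeKitToy (D : InitialThetaData F K Fbar E l P)
    (H₁ H₂ : (PlaceKit.toy D).kit.DThetaPMEllHT) : PMBaseKit.DThetaPMEllHT.IsoTorsor H₁ H₂ :=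
  PMBaseKit.DThetaPMEllHT.isoTorsor_of_negCompatModel (negCompatModel_placeKitToy D) H₁ H₂

/-- **[IUTchI] Prop 6.8 (i)** (p. 167) UNCONDITIONALLY over the toy place kit of every genuine `D`: the
`𝔽_l^{⋊±}`-symmetry `EllBridgeSymmetry` of every `𝒟-Θ^{±ell}`-Hodge theater
(`DThetaPMEllHT.ellBridgeSymmetry_of_negCompatModel` at `negCompatModel_placeKitToy`). [claim: Mochizuki2012, status: disputed] -/
theorem ellBridgeSymmetry_placeKitToy (D : InitialThetaData F K Fbar E l P)
    (H : (PlaceKit.toy D).kit.DThetaPMEllHT) : PMBaseKit.DThetaPMEllHT.EllBridgeSymmetry H :=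
  PMBaseKit.DThetaPMEllHT.ellBridgeSymmetry_of_negCompatModel (negCompatModel_placeKitToy D) H

end InitialThetaData

namespace HodgeTheaterModel

/-- **[IUTchI] Cor 6.12 (i)** (kurims p. 173), FACT-LIST row F-2605, INSTANCE FORM PROVED UNCONDITIONALLY at the
`ℱ`-kit `(unitsLink D).toFKit` of EVERY initial Θ-datum `D` (Cor 5.3 (ii) holds there:
`isomFtoDBijective_unitsLink`). [claim: Mochizuki2012, status: disputed] -/
theorem cor612iF_unitsLink (D : InitialThetaData F K Fbar E l P) : (unitsLink D).toFKit.Cor612iF :=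
  PMBaseKit.FKit.cor612iF_of_isomFtoDBijective (isomFtoDBijective_unitsLink D)

/-- **[IUTchI] Cor 6.12 (ii)** (kurims p. 173), row F-2607, INSTANCE FORM PROVED UNCONDITIONALLY at
`(unitsLink D).toFKit` for EVERY initial Θ-datum `D` and all bridges (Cor 5.3 (ii) `isomFtoDBijective_unitsLink` +
the DISCHARGED Prop 6.6 (iv) `DThetaPMBridge.gluingTorsor`). [claim: Mochizuki2012, status: disputed] -/
theorem gluingTorsorF_unitsLink (D : InitialThetaData F K Fbar E l P) (B : (unitsLink D).toFKit.ThetaPMBridge)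
    (B' : (unitsLink D).toFKit.ThetaEllBridge) : (unitsLink D).toFKit.GluingTorsorF B B' :=
  PMBaseKit.FKit.gluingTorsorF_of_isomFtoDBijective (isomFtoDBijective_unitsLink D) B B'
    (PMBaseKit.DThetaPMBridge.gluingTorsor B.dBridge B'.dBridge)

/-- **[IUTchI] Rmk 6.12.1** (kurims p. 174), row F-2608, INSTANCE FORM PROVED UNCONDITIONALLY at
`(unitsLink D).toFKit` for EVERY initial Θ-datum `D`: Cor 5.3 (ii) `isomFtoDBijective_unitsLink`, and Prop 6.8 (i)
from law (β) for the toy place kit of `D` (`InitialThetaData.negCompatModel_placeKitToy`).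
[claim: Mochizuki2012, status: disputed] -/
theorem functorialDynamicsPMF_unitsLink (D : InitialThetaData F K Fbar E l P) :
    (unitsLink D).toFKit.FunctorialDynamicsPMF :=
  PMBaseKit.FKit.functorialDynamicsPMF_of_isomFtoDBijective (isomFtoDBijective_unitsLink D)
    fun H => PMBaseKit.DThetaPMEllHT.ellBridgeSymmetry_of_negCompatModel
      (InitialThetaData.negCompatModel_placeKitToy D) H.dHT

/-- **[IUTchI] Cor 6.12 (i), Θ^±-bridges** (kurims p. 173), row F-2604, INSTANCE FORM PROVED UNCONDITIONALLY at
`(unitsLink D).toFKit` for EVERY initial Θ-datum `D`. [claim: Mochizuki2012, status: disputed] -/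
theorem thetaPMBridge_isoFToDBijective_unitsLink (D : InitialThetaData F K Fbar E l P)
    (B₁ B₂ : (unitsLink D).toFKit.ThetaPMBridge) : PMBaseKit.FKit.ThetaPMBridge.IsoFToDBijective B₁ B₂ :=
  (cor612iF_unitsLink D).1 B₁ B₂

/-- **[IUTchI] Cor 6.12 (i), Θ^{ell}-bridges** (kurims p. 173), row F-2604, INSTANCE FORM PROVED UNCONDITIONALLY at
`(unitsLink D).toFKit` for EVERY initial Θ-datum `D`. [claim: Mochizuki2012, status: disputed] -/
theorem thetaEllBridge_isoFToDBijective_unitsLink (D : InitialThetaData F K Fbar E l P)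
    (B₁ B₂ : (unitsLink D).toFKit.ThetaEllBridge) : PMBaseKit.FKit.ThetaEllBridge.IsoFToDBijective B₁ B₂ :=
  (cor612iF_unitsLink D).2.1 B₁ B₂

/-- **[IUTchI] Cor 6.12 (i), Θ^{±ell}-Hodge theaters** (kurims p. 173), row F-2604, INSTANCE FORM PROVED
UNCONDITIONALLY at `(unitsLink D).toFKit` for EVERY initial Θ-datum `D`. [claim: Mochizuki2012, status: disputed] -/
theorem thetaPMEllHT_isoFToDBijective_unitsLink (D : InitialThetaData F K Fbar E l P)
    (H₁ H₂ : (unitsLink D).toFKit.ThetaPMEllHT) : PMBaseKit.FKit.ThetaPMEllHT.IsoFToDBijective H₁ H₂ :=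
  (cor612iF_unitsLink D).2.2 H₁ H₂

/-- **[IUTchI] Cor 6.12 (i), (ii), Rmk 6.12.1 jointly** (rows F-2605/F-2607/F-2608) UNCONDITIONALLY at the `ℱ`-kit
of the KIT-RULE inhabitant `unitsLink D`, for EVERY initial Θ-datum `D` — the three named `ℱ`-level statements are
jointly satisfied, exactly as typed, at a kit indexed by the genuine places `V̲` of `D`.
[claim: Mochizuki2012, status: disputed] -/
theorem cor612_rmk6121_unitsLink (D : InitialThetaData F K Fbar E l P) :
    (unitsLink D).toFKit.Cor612iF ∧ (∀ B B', (unitsLink D).toFKit.GluingTorsorF B B') ∧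
      (unitsLink D).toFKit.FunctorialDynamicsPMF :=
  ⟨cor612iF_unitsLink D, gluingTorsorF_unitsLink D, functorialDynamicsPMF_unitsLink D⟩

end HodgeTheaterModel

end Link

end Literature.IUT.HodgeTheaters
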